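import Summits.HodgeConjecture.HodgeConjecture.Theorems.F0LD2SameLabelLineClassAtPlace
import Literature.NumberTheory.Automorphic.Liu2021.LemD1RankTwoCMSameLabelLetter
import Literature.NumberTheory.Automorphic.Liu2021.Def412AdmissibleIffParity
import Literature.NumberTheory.QuadraticForms.PrescribedNormClassesCM
import HarnessLib

/-!
# LD2 «U₂″-TRIM» (T2): the letter «R₂» ★ `LemD1RankTwoCMLetters.LemD1_4SameLabelNonsplitCM₂` IS IMPLIED BY the two booked Lem. D.1 letters
# (`LemD1_4AsPrintedNonsplitCM₂`, `LemD1_1AsPrintedCM₂`) — the MONOTONICITY theorem certifying R₂'s print-truth by inheritance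

Cell `hodgecm-mathlib`, half A line LD2 (socket `stub_S1b_facts`, books row #74), seat LD2-p01 (g0), 2026-09-02; ruling «U₂″-TRIM» = T2 (LD2-plan (g0)).
THEOREMS ONLY (no `def`, no named fact, no instance, no `sorry`); `--supports stmt-HodgeConjecture-24832`.  This is the tree-side half of the R₂ letter module
(a Literature module may not import the Summits-side ★ facts the proof needs: ★ `lemD1_4IfAsPrintedNonsplitCM₂_holds`, ★ stage B p848707).
* §1 `exists_relabelLine_flip` — the FRAME-FREE relabelling line of [Liu2021, Lem. D.1 (4)] ∕ [Omeara1963, 71:19]: for every `a ∈ (L⁺)ˣ` a line `b` whose local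
  class agrees with that of `a` exactly at the isotropic places of `(L_v², diag dV)` (★ R1 `F0P5PaydownStubRelabelUnit.stub_arith_relabelUnit_holds` with its three
  UNUSED archimedean binders dropped — same proof: ★ `RemD5.exists_eps_flip` + ★ `QuadraticForms.exists_prescribed_normClass_of_finite`).
* §2 `locF_apply_eq_of_equiv_localTypes_nonsplit'` — ★ stage B `locF_apply_eq_of_equiv_localTypes_nonsplit` (p848707) with the two GLOBAL instance binders
  `[Nontrivial ω(λ,ε_a,χ)_f]`, `[Nontrivial ω(λ,ε_{a′},χ)_f]` replaced by the LOCAL non-vanishing hypotheses `hi_a`, `hi_a′` they were only used to produce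
  (same proof otherwise, token for token).
* §3 **`lemD1_4SameLabelNonsplitCM₂_of_letters (h4 : LemD1_4AsPrintedNonsplitCM₂) (h1 : LemD1_1AsPrintedCM₂) : LemD1_4SameLabelNonsplitCM₂`** — the companion
  label `λ′ = λᶜ·χ̌` (★ `IsConjugateSymplectic.exists_companion_galConj_mul_checkOfChi`, weight one), the flip line `b` (§1), `Θ_v(λ,a,χ) ≠ 0` transported along
  the given equivalence, then §2.  Hence booking R₂ INSTEAD of L4-full + L1 weakens the books (one row, implied by the two it replaces).
HONEST LABEL: HC_CM is proved only modulo the 7 printed citations (2 remaining: hLiu418 = stmt-HodgeConjecture-24832, h413 = stmt-HodgeConjecture-24833) until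
rung 0 closes; this file discharges none of them.

## References
* [Liu2021] Y. Liu, Camb. J. Math. 9 (2021): App. D Lem. D.1 (1), (4) (p. 125–126, TeX l. 5227–5262); Rem. 4.2; Def. 4.12.
* [Omeara1963] O. T. O'Meara, *Introduction to quadratic forms* (1963), §63B Cor. 63:13a, §71 Thm. 71:19, Cor. 71:19a.
* [HarrisKudlaSweet1996] M. Harris, S. Kudla, W. J. Sweet, J. AMS 9 (1996), Thm. 6.1.
-/

set_option autoImplicit false
set_option linter.dupNamespace false

noncomputable section

open scoped Matrix Kronecker RestrictedProduct NumberField TensorProduct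
open NumberField IsDedekindDomain Filter
open Literature.NumberTheory Literature.NumberTheory.Automorphic Literature.NumberTheory.Automorphic.UnitaryGroup
open Literature.NumberTheory.GelbartRogawski1991 Literature.NumberTheory.GelbartRogawski1991.UnitaryDualPair
open Literature.NumberTheory.GelbartRogawski1991.UnitaryDualPair.WeilCoinv
open Literature.NumberTheory.GelbartRogawski1991.UnitaryDualPair.LocalSplitting
open Literature.NumberTheory.GelbartRogawski1991.GRConstruction
open Literature.NumberTheory.Weil1964 Literature.RepresentationTheory
open Literature.RepresentationTheory.HeisenbergGroup
open Literature.NumberTheory.GaloisRepresentations Literature.RepresentationTheory.HarrisKudlaSweet1996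
open Literature.NumberTheory.Automorphic.IdeleClassGroup Literature.RepresentationTheory.Liu2021
open Literature.NumberTheory.Automorphic.Liu2021 Literature.NumberTheory.Automorphic.Liu2021.Def411WeilCarriers
open Literature.NumberTheory.Automorphic.Liu2021.Def411WeilCarriersDoubling
open Literature.NumberTheory.Automorphic.Liu2021.LemD1RankTwoCMLetters
open Literature.NumberTheory.Automorphic.Liu2021.RemD5
open Summit.HodgeConjecture.HodgeConjecture.Cruxes.HLiu418.F0P5CurveThetaCompanionRelabelOfLocalFactors
open Summit.HodgeConjecture.HodgeConjecture.Cruxes.HLiu418.F0P5CurveThetaCompanionRelabelOfNonsplitIfLetter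
open Summit.HodgeConjecture.HodgeConjecture.Cruxes.HLiu418.F0P5LemD14IfNonsplitLetter
open Summit.HodgeConjecture.HodgeConjecture.Cruxes.HLiu418.F0LD2LocalTypesRankTwo

open Summit.HodgeConjecture.HodgeConjecture.Cruxes.HLiu418.F0LD2SameLabelLineClassAtPlace
open NumberField.InfinitePlace

namespace Summit.HodgeConjecture.HodgeConjecture.Cruxes.HLiu418.F0LD2SameLabelRigidityOfLetters

variable (L : Type) [Field L] [NumberField L] [IsCMField L]

/-! ## §1 The frame-free relabelling line (★ R1 with its unused archimedean binders dropped) -/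

/-- **The relabelling line of [Liu2021, Lem. D.1 (4)], frame-free**: for every `a ∈ (L⁺)ˣ` there is `a′ ∈ (L⁺)ˣ` whose local norm classes agree with those of
`a` exactly at the finite places where `(L_v², diag dV ⊗ 1)` is isotropic ([Omeara1963, 71:19]: flip the trivial collection on the finite anisotropic set, realise
it by a global `θ` with free real signs, `a′ := a·θ`) — adapted from ★ `F0P5PaydownStubRelabelUnit.stub_arith_relabelUnit_holds` (same proof; that theorem's
signature-`(1,1)`, definiteness and degree binders are not used by it). [cite: Omeara1963, §71 Thm. 71:19, Cor. 71:19a; §63B Cor. 63:13a]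
[cite: Liu2021, App. D Lem. D.1 (4) (l. 5235); Def. 4.12 (l. 2102–2108)] -/
theorem exists_relabelLine_flip
    (dV : Fin 2 → L) (hdV : ∀ i, IsCMField.complexConj L (dV i) = dV i) (hdV0 : ∀ i, dV i ≠ 0) (a : (↥(maximalRealSubfield L))ˣ) :
    ∃ a' : (↥(maximalRealSubfield L))ˣ,
      ∀ (hJh : ((Matrix.diagonal dV).map (IsCMField.complexConj L))ᵀ = Matrix.diagonal dV) (hJdet : (Matrix.diagonal dV).det ≠ 0)
          (v : HeightOneSpectrum (𝓞 ↥(maximalRealSubfield L))),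
        locF (↥(maximalRealSubfield L)) (imagUnitSq L) a' v = locF (↥(maximalRealSubfield L)) (imagUnitSq L) a v ↔
          LemD1.IsIsotropic (LemD1OfPlace.standingData L v (IsCMField.complexConj L) 2 (Matrix.diagonal dV)
            (complexConj_imagUnit L) (imagUnit_ne_zero L) le_rfl hJh hJdet) := by
  -- the frame is hermitian with non-zero determinant (the two proof arguments of the standing data)
  have hJh₀ : ((Matrix.diagonal dV).map (IsCMField.complexConj L))ᵀ = Matrix.diagonal dV := by
    rw [Matrix.diagonal_map (map_zero _), Matrix.diagonal_transpose]
    exact congrArg Matrix.diagonal (funext hdV)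
  have hJdet₀ : (Matrix.diagonal dV).det ≠ 0 := by
    rw [Matrix.det_diagonal]
    exact Finset.prod_ne_zero_iff.2 fun i _ => hdV0 i
  -- the real diagonal `t` with `diag dV = diag t ⊗ 1`, and `d = δ_L²`
  let t : Fin 2 → maximalRealSubfield L := fun i => ⟨dV i, (IsCMField.complexConj_eq_self_iff (K := L) (dV i)).1 (hdV i)⟩
  have hJ : Matrix.diagonal dV = (Matrix.diagonal t).map (algebraMap (maximalRealSubfield L) L) := by
    rw [Matrix.diagonal_map (map_zero _)]; rfl
  have ht : ∀ i, t i ≠ 0 := fun i h => hdV0 i (congrArg Subtype.val h)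
  have hd : imagUnit L * imagUnit L = algebraMap (maximalRealSubfield L) L (imagUnitSq L) := imagUnit_mul_self L
  -- (1) the anisotropic set `T`: finite, and `d` is a non-square there
  set T : Set (HeightOneSpectrum (𝓞 (maximalRealSubfield L))) := {v | ¬ LemD1.IsIsotropic
    (LemD1OfPlace.standingData L v (IsCMField.complexConj L) 2 (Matrix.diagonal dV) (complexConj_imagUnit L) (imagUnit_ne_zero L)
      le_rfl hJh₀ hJdet₀)} with hTdef
  have hTfin : T.Finite :=
    LemD1OfPlace.finite_setOf_not_isIsotropic L (IsCMField.complexConj L) (complexConj_imagUnit L) (imagUnit_ne_zero L) t hJ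
      hJh₀ hJdet₀ hd ht
  have hns : ∀ v ∈ T, ¬ IsSquare (algebraMap (maximalRealSubfield L) (v.adicCompletion (maximalRealSubfield L)) (imagUnitSq L)) :=
    fun v hv => RemD5.not_isSquare_of_not_isIsotropic L v (IsCMField.complexConj L) (complexConj_imagUnit L) (imagUnit_ne_zero L)
      t hJ hJh₀ hJdet₀ hd ht hv
  -- the flipped trivial collection `ρ`: `ρ_v = 1` off `T`, `ρ_v ≠ 1` on `T`
  obtain ⟨ρ, hoff, hon⟩ := RemD5.exists_eps_flip (imagUnitSq L) (1 : Eps (maximalRealSubfield L) (imagUnitSq L)) T hns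
  -- (2) realise `ρ` by a global `θ` (71:19 with the real signs of the totally real `L⁺` as parity valve)
  have hsupp : {v : HeightOneSpectrum (𝓞 (maximalRealSubfield L)) | ρ v ≠ 1}.Finite :=
    hTfin.subset fun v hv => by
      by_contra hvT
      exact hv ((hoff v hvT).trans (Pi.one_apply v))
  have hd0 : imagUnitSq L ≠ 0 := ne_zero_of_coe_eq_mul_self (imagUnit_ne_zero L) hd.symm
  have hdneg : ∀ (w : InfinitePlace (maximalRealSubfield L)) (hw : w.IsReal),
      InfinitePlace.embedding_of_isReal hw (imagUnitSq L) < 0 :=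
    fun w hw => embedding_of_isReal_lt_zero_of_coe_eq_mul_self (complexConj_imagUnit L) (imagUnit_ne_zero L) hd.symm w hw
  obtain ⟨w₀⟩ : Nonempty (InfinitePlace (maximalRealSubfield L)) := inferInstance
  obtain ⟨θ, hθ⟩ := Literature.NumberTheory.QuadraticForms.exists_prescribed_normClass_of_finite (maximalRealSubfield L)
    (imagUnitSq L) hd0 hdneg w₀ (IsTotallyReal.isReal w₀) ρ hsupp
  -- (3) `a′ := a · θ`
  refine ⟨a * θ, fun hJh hJdet v => ?_⟩
  have hθv : locF (↥(maximalRealSubfield L)) (imagUnitSq L) θ v = ρ v := by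
    rw [locF_apply]; exact hθ v
  -- `x · ρ_v = x ↔ ρ_v = 1` in the local norm-class group
  have key : locF (↥(maximalRealSubfield L)) (imagUnitSq L) a v * ρ v = locF (↥(maximalRealSubfield L)) (imagUnitSq L) a v ↔
      ρ v = 1 :=
    ⟨fun h => by
      simpa only [inv_mul_cancel_left, inv_mul_cancel] using
        congrArg (fun y => (locF (↥(maximalRealSubfield L)) (imagUnitSq L) a v)⁻¹ * y) h,
     fun h => by rw [h]; exact mul_one (locF (↥(maximalRealSubfield L)) (imagUnitSq L) a v)⟩
  rw [map_mul, Pi.mul_apply, hθv, key]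
  by_cases hv : v ∈ T
  · exact iff_of_false (hon v hv) (by simpa [hTdef] using hv)
  · exact iff_of_true (hoff v hv) (by simpa [hTdef] using hv)


/-! ## §2 Stage B with local non-vanishing hypotheses -/

section Place

variable {n' : ℕ} (e₁ : Fin 2 × Fin 1 ≃ Fin n') (dV : Fin 2 → L) (hdV : ∀ i, IsCMField.complexConj L (dV i) = dV i) (hdV0 : ∀ i, dV i ≠ 0)
  (lam : Literature.NumberTheory.Automorphic.IdeleClassGroup L →ₜ* Circle) (hlam : IsConjugateSymplectic L lam)
  (a a' : (Fp L)ˣ) (χ : Chi (Fp L) L (IsCMField.complexConj L))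
  (lam' : Literature.NumberTheory.Automorphic.IdeleClassGroup L →ₜ* Circle)
  (v : HeightOneSpectrum (𝓞 (Fp L)))

set_option maxHeartbeats 3200000 in -- the CM θ-package family terms (two members + the letters' family), cf. ★ R2′ assembler (800 k per member)
/-- **E₂ AT A NON-SPLIT PLACE, LOCAL NON-VANISHING HYPOTHESES** (★ p848707 `locF_apply_eq_of_equiv_localTypes_nonsplit` with `hi_a`, `hi_a′` as hypotheses).  Registered frame tokens; `λ′` the companion label (`toHeckeCharacter λ′ = (toHeckeCharacter λ)ᶜ · χ̌`); `b` a line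
with «`locF b v = locF a v` iff `(L_v², diag dV)` isotropic»; `v` non-split; the booked letters `h4` = [Liu2021, Lem. D.1 (4)] (companion family,
non-split) and `h1` = [Liu2021, Lem. D.1 (1)]; both carriers `ω(λ, ε_a, χ)_f`, `ω(λ, ε_{a′}, χ)_f` NON-ZERO.  THEN an equivalence of local types
`Θ_v(λ, a, χ) ≃ Θ_v(λ, a′, χ)` (output of ★ `nonempty_equiv_localTypes₂`) forces `locF a v = locF a′ v`.
[cite: Liu2021, App. D Lem. D.1 (1), (4) (p. 125–126); §D.1 Steps 1–3; Def. 4.1] [cite: Omeara1963, §63B] -/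
theorem locF_apply_eq_of_equiv_localTypes_nonsplit'
    (hcc : IsCMField.complexConj L * IsCMField.complexConj L = 1) (hlam' : IsConjugateSymplectic L lam')
    (hH : toHeckeCharacter L lam' =
      toHeckeCharacter L (IdeleClassGroup.galConj (IsCMField.complexConj L) lam) * HeckeCharacter.checkOfChi hcc χ)
    (hJh : ((Matrix.diagonal dV).map (IsCMField.complexConj L))ᵀ = Matrix.diagonal dV) (hJdet : (Matrix.diagonal dV).det ≠ 0)
    (b : (Fp L)ˣ)
    (hflipv : locF (Fp L) (imagUnitSq L) b v = locF (Fp L) (imagUnitSq L) a v ↔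
      LemD1.IsIsotropic (LemD1OfPlace.standingData L v (IsCMField.complexConj L) 2 (Matrix.diagonal dV)
        (complexConj_imagUnit L) (imagUnit_ne_zero L) le_rfl hJh hJdet))
    (hns : ∀ w : UnitaryGroup.PlacesOver L v, IsCMField.complexConj L • (w : HeightOneSpectrum (𝓞 L)) = w)
    (h4 : LemD1_4AsPrintedNonsplitCM₂) (h1 : LemD1_1AsPrintedCM₂)
    (hi_a : Nontrivial (TwistedCoinv.Coinv (show Representation ℂ (UnitaryGroup.localPi L (IsCMField.complexConj L) 1 (JW (Fp L) L a) v) (SchwartzBruhat (Fin n' → v.adicCompletion (Fp L))) from (((congrW L e₁ dV hdV (lineW L (TW (Fp L) a)) (complexConj_lineW L (TW (Fp L) a)) (realDiagonal_lineW L (TW (Fp L) a)) (diagonal_lineW L (TW (Fp L) a) (JW_eq (Fp L) L a)) (undoubledSplittings L e₁ dV hdV hdV0 (lineW L (TW (Fp L) a)) (complexConj_lineW L (TW (Fp L) a)) (lineW_ne_zero L (TW (Fp L) a) (isUnit_det_TW (Fp L) a)) (toHeckeCharacter L lam) (borelPlaceMeasure L) (cmFinLocalFamily L e₁ dV hdV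 hdV0 (lineW L (TW (Fp L) a)) (complexConj_lineW L (TW (Fp L) a)) (lineW_ne_zero L (TW (Fp L) a) (isUnit_det_TW (Fp L) a)) (toHeckeCharacter L lam) ((isOscillatorChar_toHeckeCharacter_iff lam).mpr hlam) (borelPlaceMeasure L))) (isSymm_TW (Fp L) a) (JW_eq (Fp L) L a))).omegaLoc v).comp (localCenter L (IsCMField.complexConj L) n' (Matrix.reindex e₁ e₁ (Matrix.diagonal dV ⊗ₖ JW (Fp L) L a)) (JW (Fp L) L a) (JW_apply_ne_zero (Fp L) L a) v)) (localCharOfCenter (Fp L) L (IsCMField.complexConj L) (JW (Fp L) L a) (JW_apply_ne_zero (Fp L) L a) χ.1 v)))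
    (hi_a' : Nontrivial (TwistedCoinv.Coinv (show Representation ℂ (UnitaryGroup.localPi L (IsCMField.complexConj L) 1 (JW (Fp L) L a') v) (SchwartzBruhat (Fin n' → v.adicCompletion (Fp L))) from (((congrW L e₁ dV hdV (lineW L (TW (Fp L) a')) (complexConj_lineW L (TW (Fp L) a')) (realDiagonal_lineW L (TW (Fp L) a')) (diagonal_lineW L (TW (Fp L) a') (JW_eq (Fp L) L a')) (undoubledSplittings L e₁ dV hdV hdV0 (lineW L (TW (Fp L) a')) (complexConj_lineW L (TW (Fp L) a')) (lineW_ne_zero L (TW (Fp L) a') (isUnit_det_TW (Fp L) a')) (toHeckeCharacter L lam) (borelPlaceMeasure L) (cmFinLocalFamily L e₁ dV hdV hdV0 (lineW L (TW (Fp L) a')) (complexConj_lineW L (TW (Fp L) a')) (lineW_ne_zero L (TW (Fp L) a') (isUnit_det_TW (Fp L) a')) (toHeckeCharacter L lam) ((isOscillatorChar_toHeckeCharacter_iff lam).mpr hlam) (borelPlaceMeasure L))) (isSymm_TW (Fp L) a') (JW_eq (Fp L) L a'))).omegaLoc v).comp (localCenter L (IsCMField.complexConj L) n' (Matrix.reindex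 e₁ e₁ (Matrix.diagonal dV ⊗ₖ JW (Fp L) L a')) (JW (Fp L) L a') (JW_apply_ne_zero (Fp L) L a') v)) (localCharOfCenter (Fp L) L (IsCMField.complexConj L) (JW (Fp L) L a') (JW_apply_ne_zero (Fp L) L a') χ.1 v)))
    (hiso : Nonempty ((show Representation ℂ (localPi L (IsCMField.complexConj L) 2 (Matrix.diagonal dV) v) _ from (TwistedCoinv.rep (localCharOfCenter (Fp L) L (IsCMField.complexConj L) (JW (Fp L) L a) (JW_apply_ne_zero (Fp L) L a) χ.1 v) (((congrW L e₁ dV hdV (lineW L (TW (Fp L) a)) (complexConj_lineW L (TW (Fp L) a)) (realDiagonal_lineW L (TW (Fp L) a)) (diagonal_lineW L (TW (Fp L) a) (JW_eq (Fp L) L a)) (undoubledSplittings L e₁ dV hdV hdV0 (lineW L (TW (Fp L) a)) (complexConj_lineW L (TW (Fp L) a)) (lineW_ne_zero L (TW (Fp L) a) (isUnit_det_TW (Fp L) a)) (toHeckeCharacter L lam) (borelPlaceMeasure L) (cmFinLocalFamily L e₁ dV hdV hdV0 (lineW L (TW (Fp L) a)) (complexConj_lineW L (TW (Fp L) a)) (lineW_ne_zero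 L (TW (Fp L) a) (isUnit_det_TW (Fp L) a)) (toHeckeCharacter L lam) ((isOscillatorChar_toHeckeCharacter_iff lam).mpr hlam) (borelPlaceMeasure L))) (isSymm_TW (Fp L) a) (JW_eq (Fp L) L a))).omegaLoc v) (commute_omegaLoc_localCenter (Fp L) L (IsCMField.complexConj L) 2 e₁ (Matrix.diagonal dV) (JW (Fp L) L a) (complexConj_imagUnit L) (imagUnit_ne_zero L) (imagUnit_mul_self L) (realDiagonal_isSymm L dV hdV) (isSymm_TW (Fp L) a) (realDiagonal_map L dV hdV).symm (JW_eq (Fp L) L a) (JW_apply_ne_zero (Fp L) L a) (congrW L e₁ dV hdV (lineW L (TW (Fp L) a)) (complexConj_lineW L (TW (Fp L) a)) (realDiagonal_lineW L (TW (Fp L) a)) (diagonal_lineW L (TW (Fp L) a) (JW_eq (Fp L) L a)) (undoubledSplittings L e₁ dV hdV hdV0 (lineW L (TW (Fp L) a)) (complexConj_lineW L (TW (Fp L) a)) (lineW_ne_zero L (TW (Fp L) a) (isUnit_det_TW (Fp L) a)) (toHeckeCharacter L lam) (borelPlaceMeasure L) (cmFinLocalFamily L e₁ dV hdV hdV0 (lineW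 L (TW (Fp L) a)) (complexConj_lineW L (TW (Fp L) a)) (lineW_ne_zero L (TW (Fp L) a) (isUnit_det_TW (Fp L) a)) (toHeckeCharacter L lam) ((isOscillatorChar_toHeckeCharacter_iff lam).mpr hlam) (borelPlaceMeasure L))) (isSymm_TW (Fp L) a) (JW_eq (Fp L) L a)) v)).comp (localLineInl L (IsCMField.complexConj L) 2 e₁ (Matrix.diagonal dV) (JW (Fp L) L a) v)).Equiv (show Representation ℂ (localPi L (IsCMField.complexConj L) 2 (Matrix.diagonal dV) v) _ from (TwistedCoinv.rep (localCharOfCenter (Fp L) L (IsCMField.complexConj L) (JW (Fp L) L a') (JW_apply_ne_zero (Fp L) L a') χ.1 v) (((congrW L e₁ dV hdV (lineW L (TW (Fp L) a')) (complexConj_lineW L (TW (Fp L) a')) (realDiagonal_lineW L (TW (Fp L) a')) (diagonal_lineW L (TW (Fp L) a') (JW_eq (Fp L) L a')) (undoubledSplittings L e₁ dV hdV hdV0 (lineW L (TW (Fp L) a')) (complexConj_lineW L (TW (Fp L) a')) (lineW_ne_zero L (TW (Fp L) a') (isUnit_det_TW (Fp L) a')) (toHeckeCharacter L lam) (borelPlaceMeasure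 L) (cmFinLocalFamily L e₁ dV hdV hdV0 (lineW L (TW (Fp L) a')) (complexConj_lineW L (TW (Fp L) a')) (lineW_ne_zero L (TW (Fp L) a') (isUnit_det_TW (Fp L) a')) (toHeckeCharacter L lam) ((isOscillatorChar_toHeckeCharacter_iff lam).mpr hlam) (borelPlaceMeasure L))) (isSymm_TW (Fp L) a') (JW_eq (Fp L) L a'))).omegaLoc v) (commute_omegaLoc_localCenter (Fp L) L (IsCMField.complexConj L) 2 e₁ (Matrix.diagonal dV) (JW (Fp L) L a') (complexConj_imagUnit L) (imagUnit_ne_zero L) (imagUnit_mul_self L) (realDiagonal_isSymm L dV hdV) (isSymm_TW (Fp L) a') (realDiagonal_map L dV hdV).symm (JW_eq (Fp L) L a') (JW_apply_ne_zero (Fp L) L a') (congrW L e₁ dV hdV (lineW L (TW (Fp L) a')) (complexConj_lineW L (TW (Fp L) a')) (realDiagonal_lineW L (TW (Fp L) a')) (diagonal_lineW L (TW (Fp L) a') (JW_eq (Fp L) L a')) (undoubledSplittings L e₁ dV hdV hdV0 (lineW L (TW (Fp L) a')) (complexConj_lineW L (TW (Fp L) a')) (lineW_ne_zero L (TW (Fp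 L) a') (isUnit_det_TW (Fp L) a')) (toHeckeCharacter L lam) (borelPlaceMeasure L) (cmFinLocalFamily L e₁ dV hdV hdV0 (lineW L (TW (Fp L) a')) (complexConj_lineW L (TW (Fp L) a')) (lineW_ne_zero L (TW (Fp L) a') (isUnit_det_TW (Fp L) a')) (toHeckeCharacter L lam) ((isOscillatorChar_toHeckeCharacter_iff lam).mpr hlam) (borelPlaceMeasure L))) (isSymm_TW (Fp L) a') (JW_eq (Fp L) L a')) v)).comp (localLineInl L (IsCMField.complexConj L) 2 e₁ (Matrix.diagonal dV) (JW (Fp L) L a') v)))) :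
    locF (Fp L) (imagUnitSq L) a v = locF (Fp L) (imagUnitSq L) a' v := by
  have hn' : 2 ≤ n' := two_le_of_finTwo_equiv e₁
  haveI : NeZero n' := ⟨by omega⟩
  -- the companion local isomorphism `Θ_v(λ′, b, χ) ≅ Θ_v(λ, a, χ)` from the PROVED «if» half of Lem. D.1 (4)
  have hcomp := areIsomorphicRep_localFactor_companion_of_lemD1_4IfAsPrintedI L e₁ dV hdV hdV0 lam hlam a χ b lam' hlam' v hcc hH
    hJh hJdet hflipv hi_a (lemD1_4IfAsPrintedNonsplitCM₂_holds L dV hdV hdV0 e₁ lam hlam a χ b lam' hlam' hcc hH v hns)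
  -- … composed with the given equivalence: `Θ_v(λ′, b, χ) ≅ Θ_v(λ, a′, χ)`
  have hiso' : AreIsomorphicRep (show Representation ℂ (localPi L (IsCMField.complexConj L) 2 (Matrix.diagonal dV) v) _ from (TwistedCoinv.rep (localCharOfCenter (Fp L) L (IsCMField.complexConj L) (JW (Fp L) L b) (JW_apply_ne_zero (Fp L) L b) χ.1 v) (((congrW L e₁ dV hdV (lineW L (TW (Fp L) b)) (complexConj_lineW L (TW (Fp L) b)) (realDiagonal_lineW L (TW (Fp L) b)) (diagonal_lineW L (TW (Fp L) b) (JW_eq (Fp L) L b)) (undoubledSplittings L e₁ dV hdV hdV0 (lineW L (TW (Fp L) b)) (complexConj_lineW L (TW (Fp L) b)) (lineW_ne_zero L (TW (Fp L) b) (isUnit_det_TW (Fp L) b)) (toHeckeCharacter L lam') (borelPlaceMeasure L) (cmFinLocalFamily L e₁ dV hdV hdV0 (lineW L (TW (Fp L) b)) (complexConj_lineW L (TW (Fp L) b)) (lineW_ne_zero L (TW (Fp L) b) (isUnit_det_TW (Fp L) b)) (toHeckeCharacter L lam') ((isOscillatorChar_toHeckeCharacter_iff lam').mpr hlam') (borelPlaceMeasure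 L))) (isSymm_TW (Fp L) b) (JW_eq (Fp L) L b))).omegaLoc v) (commute_omegaLoc_localCenter (Fp L) L (IsCMField.complexConj L) 2 e₁ (Matrix.diagonal dV) (JW (Fp L) L b) (complexConj_imagUnit L) (imagUnit_ne_zero L) (imagUnit_mul_self L) (realDiagonal_isSymm L dV hdV) (isSymm_TW (Fp L) b) (realDiagonal_map L dV hdV).symm (JW_eq (Fp L) L b) (JW_apply_ne_zero (Fp L) L b) (congrW L e₁ dV hdV (lineW L (TW (Fp L) b)) (complexConj_lineW L (TW (Fp L) b)) (realDiagonal_lineW L (TW (Fp L) b)) (diagonal_lineW L (TW (Fp L) b) (JW_eq (Fp L) L b)) (undoubledSplittings L e₁ dV hdV hdV0 (lineW L (TW (Fp L) b)) (complexConj_lineW L (TW (Fp L) b)) (lineW_ne_zero L (TW (Fp L) b) (isUnit_det_TW (Fp L) b)) (toHeckeCharacter L lam') (borelPlaceMeasure L) (cmFinLocalFamily L e₁ dV hdV hdV0 (lineW L (TW (Fp L) b)) (complexConj_lineW L (TW (Fp L) b)) (lineW_ne_zero L (TW (Fp L) b) (isUnit_det_TW (Fp L) b)) (toHeckeCharacter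 L lam') ((isOscillatorChar_toHeckeCharacter_iff lam').mpr hlam') (borelPlaceMeasure L))) (isSymm_TW (Fp L) b) (JW_eq (Fp L) L b)) v)).comp (localLineInl L (IsCMField.complexConj L) 2 e₁ (Matrix.diagonal dV) (JW (Fp L) L b) v)) (show Representation ℂ (localPi L (IsCMField.complexConj L) 2 (Matrix.diagonal dV) v) _ from (TwistedCoinv.rep (localCharOfCenter (Fp L) L (IsCMField.complexConj L) (JW (Fp L) L a') (JW_apply_ne_zero (Fp L) L a') χ.1 v) (((congrW L e₁ dV hdV (lineW L (TW (Fp L) a')) (complexConj_lineW L (TW (Fp L) a')) (realDiagonal_lineW L (TW (Fp L) a')) (diagonal_lineW L (TW (Fp L) a') (JW_eq (Fp L) L a')) (undoubledSplittings L e₁ dV hdV hdV0 (lineW L (TW (Fp L) a')) (complexConj_lineW L (TW (Fp L) a')) (lineW_ne_zero L (TW (Fp L) a') (isUnit_det_TW (Fp L) a')) (toHeckeCharacter L lam) (borelPlaceMeasure L) (cmFinLocalFamily L e₁ dV hdV hdV0 (lineW L (TW (Fp L) a')) (complexConj_lineW L (TW (Fp L) a')) (lineW_ne_zero L (TW (Fp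 L) a') (isUnit_det_TW (Fp L) a')) (toHeckeCharacter L lam) ((isOscillatorChar_toHeckeCharacter_iff lam).mpr hlam) (borelPlaceMeasure L))) (isSymm_TW (Fp L) a') (JW_eq (Fp L) L a'))).omegaLoc v) (commute_omegaLoc_localCenter (Fp L) L (IsCMField.complexConj L) 2 e₁ (Matrix.diagonal dV) (JW (Fp L) L a') (complexConj_imagUnit L) (imagUnit_ne_zero L) (imagUnit_mul_self L) (realDiagonal_isSymm L dV hdV) (isSymm_TW (Fp L) a') (realDiagonal_map L dV hdV).symm (JW_eq (Fp L) L a') (JW_apply_ne_zero (Fp L) L a') (congrW L e₁ dV hdV (lineW L (TW (Fp L) a')) (complexConj_lineW L (TW (Fp L) a')) (realDiagonal_lineW L (TW (Fp L) a')) (diagonal_lineW L (TW (Fp L) a') (JW_eq (Fp L) L a')) (undoubledSplittings L e₁ dV hdV hdV0 (lineW L (TW (Fp L) a')) (complexConj_lineW L (TW (Fp L) a')) (lineW_ne_zero L (TW (Fp L) a') (isUnit_det_TW (Fp L) a')) (toHeckeCharacter L lam) (borelPlaceMeasure L) (cmFinLocalFamily L e₁ dV hdV hdV0 (lineW L (TW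 (Fp L) a')) (complexConj_lineW L (TW (Fp L) a')) (lineW_ne_zero L (TW (Fp L) a') (isUnit_det_TW (Fp L) a')) (toHeckeCharacter L lam) ((isOscillatorChar_toHeckeCharacter_iff lam).mpr hlam) (borelPlaceMeasure L))) (isSymm_TW (Fp L) a') (JW_eq (Fp L) L a')) v)).comp (localLineInl L (IsCMField.complexConj L) 2 e₁ (Matrix.diagonal dV) (JW (Fp L) L a') v)) :=
    hiso.elim fun E => hcomp.trans (areIsomorphicRep_of_equiv E)
  -- the FULL letter read on the family `0 := (λ, a′, χ)`, `1 := (λ′, b, χ)` at `v` (★ (r1))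
  have key := lemD1_4_localFactors_of_lemD1_4AsPrintedI₂ (Fp L) L (IsCMField.complexConj L) 2 e₁ (Matrix.diagonal dV) (complexConj_imagUnit L) (imagUnit_ne_zero L) (imagUnit_mul_self L) (realDiagonal_isSymm L dV hdV) (isUnit_det_realDiagonal L dV hdV hdV0) (realDiagonal_map L dV hdV).symm (two_le_of_finTwo_equiv e₁) ![a', b] (fun _ => χ)
    (Fin.cons (α := fun i : Fin 2 => LocalSplitting.FinLocalSplittings (Fp L) L (IsCMField.complexConj L) n' (complexConj_imagUnit L)
      (imagUnit_ne_zero L) (imagUnit_mul_self L) (gram (Fp L) e₁ (realDiagonal L dV hdV) (TW (Fp L) (![a', b] i)))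
      (isSymm_gram (Fp L) e₁ (realDiagonal_isSymm L dV hdV) (isSymm_TW (Fp L) (![a', b] i)))
      (reindex_kronecker_eq_gram_map (Fp L) L e₁ (realDiagonal_map L dV hdV).symm (JW_eq (Fp L) L (![a', b] i))))
      (congrW L e₁ dV hdV (lineW L (TW (Fp L) a')) (complexConj_lineW L (TW (Fp L) a')) (realDiagonal_lineW L (TW (Fp L) a')) (diagonal_lineW L (TW (Fp L) a') (JW_eq (Fp L) L a')) (undoubledSplittings L e₁ dV hdV hdV0 (lineW L (TW (Fp L) a')) (complexConj_lineW L (TW (Fp L) a')) (lineW_ne_zero L (TW (Fp L) a') (isUnit_det_TW (Fp L) a')) (toHeckeCharacter L lam) (borelPlaceMeasure L) (cmFinLocalFamily L e₁ dV hdV hdV0 (lineW L (TW (Fp L) a')) (complexConj_lineW L (TW (Fp L) a')) (lineW_ne_zero L (TW (Fp L) a') (isUnit_det_TW (Fp L) a')) (toHeckeCharacter L lam) ((isOscillatorChar_toHeckeCharacter_iff lam).mpr hlam) (borelPlaceMeasure L))) (isSymm_TW (Fp L) a') (JW_eq (Fp L) L a')) (Fin.cons (congrW L e₁ dV hdV (lineW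 L (TW (Fp L) b)) (complexConj_lineW L (TW (Fp L) b)) (realDiagonal_lineW L (TW (Fp L) b)) (diagonal_lineW L (TW (Fp L) b) (JW_eq (Fp L) L b)) (undoubledSplittings L e₁ dV hdV hdV0 (lineW L (TW (Fp L) b)) (complexConj_lineW L (TW (Fp L) b)) (lineW_ne_zero L (TW (Fp L) b) (isUnit_det_TW (Fp L) b)) (toHeckeCharacter L lam') (borelPlaceMeasure L) (cmFinLocalFamily L e₁ dV hdV hdV0 (lineW L (TW (Fp L) b)) (complexConj_lineW L (TW (Fp L) b)) (lineW_ne_zero L (TW (Fp L) b) (isUnit_det_TW (Fp L) b)) (toHeckeCharacter L lam') ((isOscillatorChar_toHeckeCharacter_iff lam').mpr hlam') (borelPlaceMeasure L))) (isSymm_TW (Fp L) b) (JW_eq (Fp L) L b)) finZeroElim))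
    ![localMu L (toHeckeCharacter L lam), localMu L (toHeckeCharacter L lam')] (norm_localMu_pair L lam lam')
    (continuous_localMu_pair L lam lam') (localMu_pair_toLocalRing_eq_one_iff L lam hlam lam' hlam') v
    (h4 L dV hdV hdV0 e₁ lam hlam a' χ b lam' hlam' hcc hH v hns) rfl 0 1 hi_a'
  have hdisj := key.1 hiso'
  by_cases hV : LemD1.IsIsotropic (LemD1OfPlace.standingData L v (IsCMField.complexConj L) 2 (Matrix.diagonal dV)
      (complexConj_imagUnit L) (imagUnit_ne_zero L) le_rfl hJh hJdet)
  · -- ISOTROPIC: both alternatives put `a′` in the class of `b`, and `b ~ a`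
    have hsame := hdisj.elim (fun h => h.2.1) (fun h => h.2.2.1 hV)
    have hab : locF (Fp L) (imagUnitSq L) a' v = locF (Fp L) (imagUnitSq L) b v :=
      locF_apply_eq_of_sameClass_epsLine (Fp L) L (IsCMField.complexConj L) 2 (Matrix.diagonal dV) (complexConj_imagUnit L)
        (imagUnit_ne_zero L) (imagUnit_mul_self L) le_rfl hJh hJdet v a' b hsame
    exact (hab.trans (hflipv.2 hV)).symm
  · -- ANISOTROPIC
    -- the real diagonal `t` with `diag dV = diag t ⊗ 1`; `d = δ²` is a non-square at `v`
    let t : Fin 2 → Fp L := fun i => ⟨dV i, (IsCMField.complexConj_eq_self_iff (K := L) (dV i)).1 (hdV i)⟩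
    have hJ : Matrix.diagonal dV = (Matrix.diagonal t).map (algebraMap (Fp L) L) := by
      rw [Matrix.diagonal_map (map_zero _)]; rfl
    have ht : ∀ i, t i ≠ 0 := fun i h => hdV0 i (congrArg Subtype.val h)
    have hns_sq : ¬ IsSquare (algebraMap (Fp L) (v.adicCompletion (Fp L)) (imagUnitSq L)) :=
      not_isSquare_of_not_isIsotropic L v (IsCMField.complexConj L) (complexConj_imagUnit L) (imagUnit_ne_zero L) t hJ hJh hJdet
        (imagUnit_mul_self L) ht hV
    refine hdisj.elim (fun hA => ?_) (fun hB => ?_)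
    · -- (A) `λ′_v = λ_v`: then `χ̌_v = λ_v²`, and letter (1) makes `Θ_v(λ, a′, χ)` ZERO — contradiction
      exfalso
      have heq : ∀ x, localMu L (toHeckeCharacter L lam') v x = localMu L (toHeckeCharacter L lam) v x := fun x =>
        congrArg (fun m => (m.1 : (LocalRing L v)ˣ →* ℂˣ) x) hA.1
      have hH' : toHeckeCharacter L lam' =
          HeckeCharacter.galConj (IsCMField.complexConj L) (toHeckeCharacter L lam) * HeckeCharacter.checkOfChi hcc χ := by
        rw [hH, toHeckeCharacter_galConj]
      -- `χ̌_v(x) = λ_v(x)²`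
      have hsq : ∀ x : (LocalRing L v)ˣ,
          (LemD1OfPlace.standingData L v (IsCMField.complexConj L) 2 (Matrix.diagonal dV) (complexConj_imagUnit L) (imagUnit_ne_zero L)
              le_rfl hJh hJdet).check
            ((localCharOfCenter (Fp L) L (IsCMField.complexConj L) (JW (Fp L) L a') (JW_apply_ne_zero (Fp L) L a')
                (χ : UnitaryGroup.finAdelicOne (Fp L) L (IsCMField.complexConj L) →* ℂˣ) v).comp
              (LemD1OfPlace.theta L v (IsCMField.complexConj L) 2 (Matrix.diagonal dV) (complexConj_imagUnit L) (imagUnit_ne_zero L)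
                le_rfl hJh hJdet (JW (Fp L) L a'))) x =
            localMu L (toHeckeCharacter L lam) v x ^ 2 := fun x => by
        have e1 := heq x
        rw [hH', CheckOfChi.localMu_galConj_mul_checkOfChi_apply L hcc χ (complexConj_imagUnit L) (imagUnit_ne_zero L) le_rfl hJh hJdet
          (JW_apply_ne_zero (Fp L) L a') (toHeckeCharacter L lam) x] at e1
        have e2 := localMu_mul_localMu_conj_eq_one L lam hlam v x
        rw [eq_inv_of_mul_eq_one_right e2, inv_mul_eq_iff_eq_mul] at e1
        rw [e1, sq]
      -- letter (1) at the datum `(λ, a′, χ, v)`: zero iff (field ∧ anisotropic ∧ `χ̌ = μ²`)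
      have hD1 := (h1 L dV hdV hdV0 e₁ χ a' lam hlam v).2
      have hsub := hD1.2 ⟨isField_localRing_of_not_isSquare L v (IsCMField.complexConj L) (complexConj_imagUnit L) (imagUnit_ne_zero L)
          (imagUnit_mul_self L) hns_sq,
        ⟨(LemD1Data.isAnisotropic_iff_not_isIsotropic _).2 hV, rfl⟩, hsq⟩
      have hnt := (nontrivial_localType₂_iff_quot (Fp L) L (IsCMField.complexConj L) 2 e₁ (Matrix.diagonal dV) (complexConj_imagUnit L) (imagUnit_ne_zero L) (imagUnit_mul_self L) (realDiagonal_isSymm L dV hdV) (isUnit_det_realDiagonal L dV hdV hdV0) (realDiagonal_map L dV hdV).symm (two_le_of_finTwo_equiv e₁) ![a', b] (fun _ => χ)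
        (Fin.cons (α := fun i : Fin 2 => LocalSplitting.FinLocalSplittings (Fp L) L (IsCMField.complexConj L) n' (complexConj_imagUnit L)
          (imagUnit_ne_zero L) (imagUnit_mul_self L) (gram (Fp L) e₁ (realDiagonal L dV hdV) (TW (Fp L) (![a', b] i)))
          (isSymm_gram (Fp L) e₁ (realDiagonal_isSymm L dV hdV) (isSymm_TW (Fp L) (![a', b] i)))
          (reindex_kronecker_eq_gram_map (Fp L) L e₁ (realDiagonal_map L dV hdV).symm (JW_eq (Fp L) L (![a', b] i))))
          (congrW L e₁ dV hdV (lineW L (TW (Fp L) a')) (complexConj_lineW L (TW (Fp L) a')) (realDiagonal_lineW L (TW (Fp L) a')) (diagonal_lineW L (TW (Fp L) a') (JW_eq (Fp L) L a')) (undoubledSplittings L e₁ dV hdV hdV0 (lineW L (TW (Fp L) a')) (complexConj_lineW L (TW (Fp L) a')) (lineW_ne_zero L (TW (Fp L) a') (isUnit_det_TW (Fp L) a')) (toHeckeCharacter L lam) (borelPlaceMeasure L) (cmFinLocalFamily L e₁ dV hdV hdV0 (lineW L (TW (Fp L) a')) (complexConj_lineW L (TW (Fp L) a')) (lineW_ne_zero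 L (TW (Fp L) a') (isUnit_det_TW (Fp L) a')) (toHeckeCharacter L lam) ((isOscillatorChar_toHeckeCharacter_iff lam).mpr hlam) (borelPlaceMeasure L))) (isSymm_TW (Fp L) a') (JW_eq (Fp L) L a')) (Fin.cons (congrW L e₁ dV hdV (lineW L (TW (Fp L) b)) (complexConj_lineW L (TW (Fp L) b)) (realDiagonal_lineW L (TW (Fp L) b)) (diagonal_lineW L (TW (Fp L) b) (JW_eq (Fp L) L b)) (undoubledSplittings L e₁ dV hdV hdV0 (lineW L (TW (Fp L) b)) (complexConj_lineW L (TW (Fp L) b)) (lineW_ne_zero L (TW (Fp L) b) (isUnit_det_TW (Fp L) b)) (toHeckeCharacter L lam') (borelPlaceMeasure L) (cmFinLocalFamily L e₁ dV hdV hdV0 (lineW L (TW (Fp L) b)) (complexConj_lineW L (TW (Fp L) b)) (lineW_ne_zero L (TW (Fp L) b) (isUnit_det_TW (Fp L) b)) (toHeckeCharacter L lam') ((isOscillatorChar_toHeckeCharacter_iff lam').mpr hlam') (borelPlaceMeasure L))) (isSymm_TW (Fp L) b) (JW_eq (Fp L) L b)) finZeroElim))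
        ![localMu L (toHeckeCharacter L lam), localMu L (toHeckeCharacter L lam')] (norm_localMu_pair L lam lam')
        (continuous_localMu_pair L lam lam') (localMu_pair_toLocalRing_eq_one_iff L lam hlam lam' hlam') v 0).2 hi_a'
      exact (not_nontrivial_iff_subsingleton.mpr hsub) hnt
    · -- (B) the companion alternative: `a′ ≁ b` and `b ≁ a` at the anisotropic `v`, so `a′ ~ a` (two classes)
      have hne1 : locF (Fp L) (imagUnitSq L) a' v ≠ locF (Fp L) (imagUnitSq L) b v :=
        (not_sameClass_epsLine_iff_locF_apply_ne (Fp L) L (IsCMField.complexConj L) 2 (Matrix.diagonal dV) (complexConj_imagUnit L)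
          (imagUnit_ne_zero L) (imagUnit_mul_self L) le_rfl hJh hJdet v a' b).1 (hB.2.2.2 hV)
      have hne2 : locF (Fp L) (imagUnitSq L) b v ≠ locF (Fp L) (imagUnitSq L) a v := fun h => hV (hflipv.1 h)
      by_contra hne3
      have h1' := (ne_iff_flip_of_not_isSquare v (imagUnitSq L) hns_sq _ _).1 hne1
      have h2' := (ne_iff_flip_of_not_isSquare v (imagUnitSq L) hns_sq _ _).1 hne2
      have h3' := (ne_iff_flip_of_not_isSquare v (imagUnitSq L) hns_sq _ _).1 hne3
      tauto


end Place

/-! ## §3 The monotonicity theorem: R₂ from the two booked letters -/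

set_option maxHeartbeats 1600000 in -- the CM θ-package terms of the letter's binders
/-- **«R₂» IS IMPLIED BY L4-full + L1**: `LemD1_4SameLabelNonsplitCM₂` from ★ `LemD1_4AsPrintedNonsplitCM₂` and ★ `LemD1_1AsPrintedCM₂` — companion label
`λ′ = λᶜ·χ̌` (weight one), frame-free flip line `b` (§1), `Θ_v(λ, a, χ) ≠ 0` along the given equivalence, then §2.
[cite: Liu2021, App. D Lem. D.1 (1), (4) (p. 125–126); Rem. 4.2] [cite: Omeara1963, §71 Thm. 71:19] -/
theorem lemD1_4SameLabelNonsplitCM₂_of_letters (h4 : LemD1_4AsPrintedNonsplitCM₂) (h1 : LemD1_1AsPrintedCM₂) :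
    LemD1_4SameLabelNonsplitCM₂ := by
  intro L _ _ _ dV hdV hdV0 n' e₁ lam hlam hw a a' χ v hns hi_a' hiso
  have hcc : IsCMField.complexConj L * IsCMField.complexConj L = 1 := by
    ext y
    exact IsCMField.complexConj_apply_apply L y
  obtain ⟨lam', hH, hlam', -, -⟩ := hlam.exists_companion_galConj_mul_checkOfChi hcc χ hw
  have hJh : ((Matrix.diagonal dV).map (IsCMField.complexConj L))ᵀ = Matrix.diagonal dV := by
    rw [Matrix.diagonal_map (map_zero _), Matrix.diagonal_transpose]
    exact congrArg Matrix.diagonal (funext hdV)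
  have hJdet : (Matrix.diagonal dV).det ≠ 0 := by
    rw [Matrix.det_diagonal]
    exact Finset.prod_ne_zero_iff.2 fun i _ => hdV0 i
  obtain ⟨b, hb⟩ := exists_relabelLine_flip L dV hdV hdV0 a
  -- `Θ_v(λ, a, χ) ≠ 0`: transported back along the equivalence (`Nonempty.elim`, not `obtain`)
  have hi_a : Nontrivial (TwistedCoinv.Coinv (show Representation ℂ (UnitaryGroup.localPi L (IsCMField.complexConj L) 1 (JW (Fp L) L a) v) (SchwartzBruhat (Fin n' → v.adicCompletion (Fp L))) from (((congrW L e₁ dV hdV (lineW L (TW (Fp L) a)) (complexConj_lineW L (TW (Fp L) a)) (realDiagonal_lineW L (TW (Fp L) a)) (diagonal_lineW L (TW (Fp L) a) (JW_eq (Fp L) L a)) (undoubledSplittings L e₁ dV hdV hdV0 (lineW L (TW (Fp L) a)) (complexConj_lineW L (TW (Fp L) a)) (lineW_ne_zero L (TW (Fp L) a) (isUnit_det_TW (Fp L) a)) (toHeckeCharacter L lam) (borelPlaceMeasure L) (cmFinLocalFamily L e₁ dV hdV hdV0 (lineW L (TW (Fp L) a)) (complexConj_lineW L (TW (Fp L)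 a)) (lineW_ne_zero L (TW (Fp L) a) (isUnit_det_TW (Fp L) a)) (toHeckeCharacter L lam) ((isOscillatorChar_toHeckeCharacter_iff lam).mpr hlam) (borelPlaceMeasure L))) (isSymm_TW (Fp L) a) (JW_eq (Fp L) L a))).omegaLoc v).comp (localCenter L (IsCMField.complexConj L) n' (Matrix.reindex e₁ e₁ (Matrix.diagonal dV ⊗ₖ JW (Fp L) L a)) (JW (Fp L) L a) (JW_apply_ne_zero (Fp L) L a) v)) (localCharOfCenter (Fp L) L (IsCMField.complexConj L) (JW (Fp L) L a) (JW_apply_ne_zero (Fp L) L a) χ.1 v)) :=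
    haveI := hi_a'; hiso.elim fun E => E.toLinearEquiv.toEquiv.nontrivial
  exact locF_apply_eq_of_equiv_localTypes_nonsplit' L e₁ dV hdV hdV0 lam hlam a a' χ lam' v hcc hlam' hH hJh hJdet b (hb hJh hJdet v) hns
    h4 h1 hi_a hi_a' hiso

end Summit.HodgeConjecture.HodgeConjecture.Cruxes.HLiu418.F0LD2SameLabelRigidityOfLetters

end
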